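/-
Copyright (c) 2026 the pub-hodgecm-mathlib formalisation cell (harness21).  Prover seat hodgecm-mathlib-K2E3-p32 (g0), HCML Track B «K2-LIT» (close-out strike line L4
`stub_StCharTS`), h413 = `stmt-HodgeConjecture-24833`, line `K2_E3_EllipticInputs`, unit U4 «Keys», PART «U4Keys» socket :155 (U4f-χ₁-ram-one-d0B)
`sig_K2E3KeysThmTwoContractingRamifiedCharOneDepthZeroNormTrivial` (LINE-LEAD K2E3-plan (g5), deal D162 «d0B lead ∕ consumer», cell «U4-RAM»; Z3-c SHARED FRAME v1 (K2E3-p03 (g9))):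
THE SOCKET :155 AT AN INERT PLACE MODULO THE THREE SHELL IDENTITIES — basis-free, determinant-free.  2026-09-04.
-/
import Summits.HodgeConjecture.HodgeConjecture.Theorems.K2E3BranchBCasselmanPairClosedForms      -- ★∕📤 (this seat) (II)-c part 2: `h11v`, `hwwv` from the shell identities; brings part 1 (`hi₁₁`, `hiw₂`, `chi2_neg_one_sq`)
import Summits.HodgeConjecture.HodgeConjecture.Theorems.K2E3KeysThmTwoDepthZeroBranchBAssembly   -- ★ (this seat) reducible + big-cell entries ⟹ `∃ η`
import Summits.HodgeConjecture.HodgeConjecture.Theorems.K2E3BranchBTypeBasisCM                  -- ★ (this seat) the normalised `(I, χ̃)`-type basis exists in Branch B at depth zero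
import Summits.HodgeConjecture.HodgeConjecture.Theorems.K2E3BranchBShellRegions                 -- ★ (this seat) the shell regions are Borel (`hSgt`, `hSge`, `hSh0` discharged)
import HarnessLib

/-!
# K2 ∕ E3 «EllipticInputs», unit U4 «Keys» — (U4f-χ₁-ram-one-d0B) THE SOCKET :155 AT AN INERT PLACE, MODULO THE THREE SHELL IDENTITIES OF PAPER-Z3 §1:
# `i(χ₁, 1)` reducible (χ₁ contracting, non-unitary, depth zero, Branch B; `v` non-split, unramified) ⟹ `χ₁ = η · ‖·‖^{1∕2}`, `η` a quadratic character extension — given, on the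
# frame-v1 integrand `F₀(n) = χ₁((σz)⁻¹)‖z‖⁻¹` of `N(L⁺_v)`: the torus scaling `∫_{S_ge} = ∫_{Sh 0} + ∫_{Sh 1} + Y²∫_{S_ge}`, the shell values `∫_{Sh 1} = ε₀Y·((q−1)∕q²)·V`, `∫_{Sh 0} = −ε₀·((q−1)∕q²)·V`
# [Keys1984 §3, §7 Thm (2); Casselman1980 §3; Casselman1995 §6.4, Thm. 6.6.2; Rogawski1990 §12.1–§12.2; Roche1998 §3–§4]

Cell `pub/hodgecm-mathlib`, crux H413 = `stmt-HodgeConjecture-24833`, route of record `HCCMUnconditional`; chair K2-lead (g2), LINE-LEAD∕dealer K2E3-plan (g5), architect K2E3-p25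
(g3); cell «U4-RAM» (Z3-c frame v1, K2E3-p03 (g9)).  THEOREMS ONLY (no `def`, no `instance`, no `notation`, no named-fact hypothesis, no `sorry`); lane
`--supports stmt-HodgeConjecture-24833 --as helper`, count-neutral.  NOT THE PAYER: the three shell identities (`hscal`, `h1` = (II)-a `K2E3BranchBShellScaling`; `h0` = (II)-b3
`K2E3BranchBShellZero`, both UNFILED when the cell's seats closed 2026-09-04T16:57Z), `IntegrableOn F₀ S_ge`, the Borel-ness of the three regions and the sign letter `ε₀² = 1`
(★ `K2E3BranchBSkewUnitSign.apply_skew_unit_sq` for `ε₀ = χ₁(δ₀)`) remain hypotheses; dyadic inert and ramified places are separate theorems.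

THE POINT.  Everything else of PAPER-Z3-DepthZeroInert's Branch-B proof is ★ by name; this module composes it into ONE basis-free statement: ★ `K2E3BranchBTypeBasisCM` (the normalised
`(I, χ̃)`-type basis `(f₁, f_w)` exists in Branch B at depth zero) → ★ (II)-c `K2E3BranchBCasselmanPairClosedForms.integral_weyl_one_eq_of_shells` ∕ `integral_weyl_weyl_eq_of_shells`
(`h11v`, `hwwv` from the shell identities) and ★ `K2E3BranchBCasselmanPairEntries.integrable_toFun_weyl_mul` ∕ `integrable_toFun_conj_weyl` (`hi₁₁`, `hiw₂`), ★ `chi2_neg_one_sq`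
(`c₂ = χ₂(−1)`, `c₂² = 1` at `χ₂ = 1`) → ★ `K2E3KeysThmTwoDepthZeroBranchBAssembly.exists_eta_of_reducible_of_bigCellEntries` (reducible ⟹ type vector ⟹ `det M = 0` ⟹ `Y = −1∕q` ⟹ Z5).
* **`exists_eta_of_reducible_of_shells`**.
HONEST LABEL.  HC_CM is proved only modulo the 7 printed citations (2 remaining named inputs: hLiu418 = `stmt-HodgeConjecture-24832`, h413 = `stmt-HodgeConjecture-24833`) until rung 0
closes; count-neutral — this file does NOT pay the leaf; no printed citation is discharged.

## References
* [Keys1984] D. Keys, Compositio Math. 51 (1984), §3, §7 Theorem (2) p. 126.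
* [Casselman1980] W. Casselman, Compositio Math. 40 (1980), §3.
* [Casselman1995] W. Casselman, *Introduction to the theory of admissible representations of `p`-adic reductive groups* (1995), §6.4, Thm. 6.6.2.
* [Rogawski1990] J. Rogawski, Ann. of Math. Stud. 123 (1990), §12.1 p. 171, §12.2 (1)–(2) p. 173.
* [Roche1998] A. Roche, Ann. Sci. ÉNS (4) 31 (1998), §3–§4.
-/

set_option autoImplicit false
-- the mandated namespace has the single-problem summit's repeated segment (`HodgeConjecture.HodgeConjecture`)
set_option linter.dupNamespace false

noncomputable section

open NumberField IsDedekindDomain MeasureTheory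
open scoped Matrix MatrixGroups WithZero Valued NNReal
open Literature.NumberTheory Literature.NumberTheory.Automorphic Literature.NumberTheory.Automorphic.UnitaryGroup
open Literature.NumberTheory.Rogawski1990

namespace Summit.HodgeConjecture.HodgeConjecture.Cruxes.H413.K2E3KeysThmTwoDepthZeroBranchBInert

open Summit.HodgeConjecture.HodgeConjecture.Cruxes.H413
open Summit.HodgeConjecture.HodgeConjecture.Cruxes.H413.K2E3DepthZeroIwahoriCharacterCM
open Summit.HodgeConjecture.HodgeConjecture.Cruxes.H413.K2E3BranchATorusWitnessCM

variable (L : Type) [Field L] [NumberField L] [IsCMField L] (v : HeightOneSpectrum (𝓞 ↥(maximalRealSubfield L)))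
  (w : PlacesOver L v) (hw : IsCMField.complexConj L • w.1 = w.1)
  (eA : Gqs L v ≃ₜ* ↥(unitaryGroupOfForm (galAdicCompletionMap (L := L) (IsCMField.complexConj L) hw) ((StdForm.antidiagonal 3).over (w.1.adicCompletion L))))
  (heA : ∀ g : Gqs L v,
    ((eA g : ↥(unitaryGroupOfForm (galAdicCompletionMap (L := L) (IsCMField.complexConj L) hw) ((StdForm.antidiagonal 3).over (w.1.adicCompletion L)))) :
        GL (Fin 3) (w.1.adicCompletion L)) =
      ((localNonsplitEquiv (IsCMField.complexConj L) (qsForm L) (IsCMField.complexConj_ne_one L) w hw g :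
        ↥(unitaryGroupOfForm (galAdicCompletionMap (L := L) (IsCMField.complexConj L) hw) (placeForm (qsForm L) w.1))) : GL (Fin 3) (w.1.adicCompletion L)))
  {ϖ : w.1.adicCompletion L} (hϖ : Valued.v ϖ = WithZero.exp (-1 : ℤ))
  (g₁ : GL (Fin 3) (w.1.adicCompletion L)) (hg₁ : (g₁ : Matrix (Fin 3) (Fin 3) (w.1.adicCompletion L)) = Matrix.diagonal ![(1 : w.1.adicCompletion L), 1, ϖ])
  (K0 K1 I : Subgroup (Gqs L v))
  (hK0 : K0 = ((glInt 3 (w.1.adicCompletion L)).subgroupOf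
    (unitaryGroupOfForm (galAdicCompletionMap (L := L) (IsCMField.complexConj L) hw) ((StdForm.antidiagonal 3).over (w.1.adicCompletion L)))).comap
      eA.toMulEquiv.toMonoidHom)
  (hK1 : K1 = (((glInt 3 (w.1.adicCompletion L)).map (MulAut.conj g₁).toMonoidHom).subgroupOf
    (unitaryGroupOfForm (galAdicCompletionMap (L := L) (IsCMField.complexConj L) hw) ((StdForm.antidiagonal 3).over (w.1.adicCompletion L)))).comap
      eA.toMulEquiv.toMonoidHom)
  (hI : I = K0 ⊓ K1)
  (w₀ : ↥(unitaryGroupOfForm (conjLocal L (IsCMField.complexConj L) v) (cmLocalForm L 3 v))) (hw₀ : Units.val (w₀ : GL (Fin 3) (LocalRing L v)) = cmLocalForm L 3 v)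

/-! ## :155 at an inert place, modulo the three shell identities -/

open Classical in
include hw heA hϖ hg₁ hK0 hK1 hI hw₀ in
set_option maxHeartbeats 4000000 in
set_option synthInstance.maxHeartbeats 400000 in
-- the `SmoothInd` carrier on `U(Φ₃)(L⁺_v)` (class of ★ `K2E3KeysThmTwoDepthZeroBranchBAssembly`)
/-- **THE SOCKET :155 AT AN INERT PLACE, MODULO THE THREE SHELL IDENTITIES.**  (G3)-frame, `w₀` the element of matrix `Φ₃`, `μ` a Haar measure on `N(L⁺_v)`; `v` non-split and
UNRAMIFIED in `L`; `χ₁` continuous, non-unitary, contracting, trivial on principal units (depth zero), `χ₁(u·σu) = 1` on the units of valuation one (Branch B); on the frame-v1 integrand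
`F₀(n) = χ₁((σz)⁻¹)·‖z‖⁻¹` (`z = n₀₂`; `0` off the units): the regions `S_gt = {|z|_w > 1}`, `S_ge = {|z|_w ≥ 1}`, `Sh 0 = {|z|_w = 1}` are Borel, `F₀` is integrable on `S_ge`, and with a sign
`ε₀` (`ε₀² = 1`), `Y = χ₁(ϖ̂)`, `q = N𝔭_v`, `V = μ{|z|_w ≤ 1}`: `∫_{S_ge} F₀ = ∫_{Sh 0} F₀ + ∫_{Sh 1} F₀ + Y²·∫_{S_ge} F₀` (torus scaling), `∫_{Sh 1} F₀ = ε₀·Y·((q−1)∕q²)·V` (shell one),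
`∫_{Sh 0} F₀ = −(ε₀·((q−1)∕q²)·V)` (shell zero).  If `i(χ₁, 1)` is reducible then **`χ₁ = η · ‖·‖^{1∕2}` for a continuous quadratic character extension `η`** — the second disjunct
of :155.  Proof: ★ basis → ★ (II)-c heads `h11v hwwv hi₁₁ hiw₂` → ★ `exists_eta_of_reducible_of_bigCellEntries` (`c₂ = χ₂(−1) = 1`). [cite: Keys1984, §3, §7 Theorem (2) p. 126]
[cite: Casselman1980, §3] [cite: Casselman1995, §6.4, Thm. 6.6.2] [cite: Rogawski1990, §12.2 (1)–(2) p. 173] [cite: Roche1998, §3–§4] -/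
theorem exists_eta_of_reducible_of_shells
    (hns : ∀ w' : PlacesOver L v, IsCMField.complexConj L • w'.1 = w'.1) (hunr : Algebra.IsUnramifiedIn (𝓞 L) v.asIdeal)
    (χ₁ : (LocalRing L v)ˣ →* ℂˣ) (h₁ : Continuous fun x => ((χ₁ x : ℂˣ) : ℂ)) (hnu : ∃ x, ‖((χ₁ x : ℂˣ) : ℂ)‖ ≠ 1)
    (hcontr : ∀ x : (LocalRing L v)ˣ, unitModulusChar (LocalRing L v) x < 1 → ‖((χ₁ x : ℂˣ) : ℂ)‖ < 1)
    (hdepth : ∀ u : (LocalRing L v)ˣ, (∀ w' : PlacesOver L v, Valued.v (((u : LocalRing L v) w') - 1) < 1) → χ₁ u = 1)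
    (hB : ∀ u : (LocalRing L v)ˣ, (∀ w' : PlacesOver L v, Valued.v ((u : LocalRing L v) w') = 1) →
      χ₁ (u * Units.map (conjLocal L (IsCMField.complexConj L) v : LocalRing L v →* LocalRing L v) u) = 1)
    [MeasurableSpace ↥(cmBorelTriple L 3 v).N] [BorelSpace ↥(cmBorelTriple L 3 v).N] (μ : Measure ↥(cmBorelTriple L 3 v).N) [μ.IsHaarMeasure]
    (hSgt : MeasurableSet {m : ↥(cmBorelTriple L 3 v).N | 1 < Valued.v (((((m : ↥(unitaryGroupOfForm (conjLocal L (IsCMField.complexConj L) v) (cmLocalForm L 3 v))) : GL (Fin 3) (LocalRing L v)) : Matrix (Fin 3) (Fin 3) (LocalRing L v)) 0 2) w)}) (hSge : MeasurableSet {m : ↥(cmBorelTriple L 3 v).N | 1 ≤ Valued.v (((((m : ↥(unitaryGroupOfForm (conjLocal L (IsCMField.complexConj L) v) (cmLocalForm L 3 v))) : GL (Fin 3) (LocalRing L v)) : Matrix (Fin 3) (Fin 3) (LocalRing L v)) 0 2) w)}) (hSh0 : MeasurableSet {m : ↥(cmBorelTriple L 3 v).N | Valued.v (((((m : ↥(unitaryGroupOfForm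 (conjLocal L (IsCMField.complexConj L) v) (cmLocalForm L 3 v))) : GL (Fin 3) (LocalRing L v)) : Matrix (Fin 3) (Fin 3) (LocalRing L v)) 0 2) w) = 1})
    (hint : IntegrableOn (fun n : ↥(cmBorelTriple L 3 v).N =>
        if h : IsUnit ((((n : ↥(unitaryGroupOfForm (conjLocal L (IsCMField.complexConj L) v) (cmLocalForm L 3 v))) : GL (Fin 3) (LocalRing L v)) : Matrix (Fin 3) (Fin 3) (LocalRing L v)) 0 2) then
          ((((χ₁ (Units.map ((conjLocal L (IsCMField.complexConj L) v) : LocalRing L v →* LocalRing L v) h.unit))⁻¹ : ℂˣ) : ℂ) *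
            ((((unitModulusChar (LocalRing L v) h.unit)⁻¹ : ℝ≥0) : ℝ) : ℂ))
        else 0) {m : ↥(cmBorelTriple L 3 v).N | 1 ≤ Valued.v (((((m : ↥(unitaryGroupOfForm (conjLocal L (IsCMField.complexConj L) v) (cmLocalForm L 3 v))) : GL (Fin 3) (LocalRing L v)) : Matrix (Fin 3) (Fin 3) (LocalRing L v)) 0 2) w)} μ)
    (ε₀ : ℂ) (hε : ε₀ ^ 2 = 1)
    (hscal : ∫ n in {m : ↥(cmBorelTriple L 3 v).N | 1 ≤ Valued.v (((((m : ↥(unitaryGroupOfForm (conjLocal L (IsCMField.complexConj L) v) (cmLocalForm L 3 v))) : GL (Fin 3) (LocalRing L v)) : Matrix (Fin 3) (Fin 3) (LocalRing L v)) 0 2) w)}, (fun n : ↥(cmBorelTriple L 3 v).N =>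
        if h : IsUnit ((((n : ↥(unitaryGroupOfForm (conjLocal L (IsCMField.complexConj L) v) (cmLocalForm L 3 v))) : GL (Fin 3) (LocalRing L v)) : Matrix (Fin 3) (Fin 3) (LocalRing L v)) 0 2) then
          ((((χ₁ (Units.map ((conjLocal L (IsCMField.complexConj L) v) : LocalRing L v →* LocalRing L v) h.unit))⁻¹ : ℂˣ) : ℂ) *
            ((((unitModulusChar (LocalRing L v) h.unit)⁻¹ : ℝ≥0) : ℝ) : ℂ))
        else 0) n ∂μ =
      (∫ n in {m : ↥(cmBorelTriple L 3 v).N | Valued.v (((((m : ↥(unitaryGroupOfForm (conjLocal L (IsCMField.complexConj L) v) (cmLocalForm L 3 v))) : GL (Fin 3) (LocalRing L v)) : Matrix (Fin 3) (Fin 3) (LocalRing L v)) 0 2) w) = 1}, (fun n : ↥(cmBorelTriple L 3 v).N =>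
        if h : IsUnit ((((n : ↥(unitaryGroupOfForm (conjLocal L (IsCMField.complexConj L) v) (cmLocalForm L 3 v))) : GL (Fin 3) (LocalRing L v)) : Matrix (Fin 3) (Fin 3) (LocalRing L v)) 0 2) then
          ((((χ₁ (Units.map ((conjLocal L (IsCMField.complexConj L) v) : LocalRing L v →* LocalRing L v) h.unit))⁻¹ : ℂˣ) : ℂ) *
            ((((unitModulusChar (LocalRing L v) h.unit)⁻¹ : ℝ≥0) : ℝ) : ℂ))
        else 0) n ∂μ) + (∫ n in {m : ↥(cmBorelTriple L 3 v).N | Valued.v (((((m : ↥(unitaryGroupOfForm (conjLocal L (IsCMField.complexConj L) v) (cmLocalForm L 3 v))) : GL (Fin 3) (LocalRing L v)) : Matrix (Fin 3) (Fin 3) (LocalRing L v)) 0 2) w) = WithZero.exp (1 : ℤ)}, (fun n : ↥(cmBorelTriple L 3 v).N =>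
        if h : IsUnit ((((n : ↥(unitaryGroupOfForm (conjLocal L (IsCMField.complexConj L) v) (cmLocalForm L 3 v))) : GL (Fin 3) (LocalRing L v)) : Matrix (Fin 3) (Fin 3) (LocalRing L v)) 0 2) then
          ((((χ₁ (Units.map ((conjLocal L (IsCMField.complexConj L) v) : LocalRing L v →* LocalRing L v) h.unit))⁻¹ : ℂˣ) : ℂ) *
            ((((unitModulusChar (LocalRing L v) h.unit)⁻¹ : ℝ≥0) : ℝ) : ℂ))
        else 0) n ∂μ) +
        ((χ₁ (isUnit_toLocalRing_uniformizer L v).unit : ℂˣ) : ℂ) ^ 2 * ∫ n in {m : ↥(cmBorelTriple L 3 v).N | 1 ≤ Valued.v (((((m : ↥(unitaryGroupOfForm (conjLocal L (IsCMField.complexConj L) v) (cmLocalForm L 3 v))) : GL (Fin 3) (LocalRing L v)) : Matrix (Fin 3) (Fin 3) (LocalRing L v)) 0 2) w)}, (fun n : ↥(cmBorelTriple L 3 v).N =>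
        if h : IsUnit ((((n : ↥(unitaryGroupOfForm (conjLocal L (IsCMField.complexConj L) v) (cmLocalForm L 3 v))) : GL (Fin 3) (LocalRing L v)) : Matrix (Fin 3) (Fin 3) (LocalRing L v)) 0 2) then
          ((((χ₁ (Units.map ((conjLocal L (IsCMField.complexConj L) v) : LocalRing L v →* LocalRing L v) h.unit))⁻¹ : ℂˣ) : ℂ) *
            ((((unitModulusChar (LocalRing L v) h.unit)⁻¹ : ℝ≥0) : ℝ) : ℂ))
        else 0) n ∂μ)
    (h1 : ∫ n in {m : ↥(cmBorelTriple L 3 v).N | Valued.v (((((m : ↥(unitaryGroupOfForm (conjLocal L (IsCMField.complexConj L) v) (cmLocalForm L 3 v))) : GL (Fin 3) (LocalRing L v)) : Matrix (Fin 3) (Fin 3) (LocalRing L v)) 0 2) w) = WithZero.exp (1 : ℤ)}, (fun n : ↥(cmBorelTriple L 3 v).N =>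
        if h : IsUnit ((((n : ↥(unitaryGroupOfForm (conjLocal L (IsCMField.complexConj L) v) (cmLocalForm L 3 v))) : GL (Fin 3) (LocalRing L v)) : Matrix (Fin 3) (Fin 3) (LocalRing L v)) 0 2) then
          ((((χ₁ (Units.map ((conjLocal L (IsCMField.complexConj L) v) : LocalRing L v →* LocalRing L v) h.unit))⁻¹ : ℂˣ) : ℂ) *
            ((((unitModulusChar (LocalRing L v) h.unit)⁻¹ : ℝ≥0) : ℝ) : ℂ))
        else 0) n ∂μ =
      ε₀ * ((χ₁ (isUnit_toLocalRing_uniformizer L v).unit : ℂˣ) : ℂ) * ((((Ideal.absNorm v.asIdeal : ℝ) : ℂ) - 1) / ((Ideal.absNorm v.asIdeal : ℝ) : ℂ) ^ 2) * ((μ.real {m : ↥(cmBorelTriple L 3 v).N | Valued.v (((((m : ↥(unitaryGroupOfForm (conjLocal L (IsCMField.complexConj L) v) (cmLocalForm L 3 v))) : GL (Fin 3) (LocalRing L v)) : Matrix (Fin 3) (Fin 3) (LocalRing L v)) 0 2) w) ≤ 1} : ℝ) : ℂ))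
    (h0 : ∫ n in {m : ↥(cmBorelTriple L 3 v).N | Valued.v (((((m : ↥(unitaryGroupOfForm (conjLocal L (IsCMField.complexConj L) v) (cmLocalForm L 3 v))) : GL (Fin 3) (LocalRing L v)) : Matrix (Fin 3) (Fin 3) (LocalRing L v)) 0 2) w) = 1}, (fun n : ↥(cmBorelTriple L 3 v).N =>
        if h : IsUnit ((((n : ↥(unitaryGroupOfForm (conjLocal L (IsCMField.complexConj L) v) (cmLocalForm L 3 v))) : GL (Fin 3) (LocalRing L v)) : Matrix (Fin 3) (Fin 3) (LocalRing L v)) 0 2) then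
          ((((χ₁ (Units.map ((conjLocal L (IsCMField.complexConj L) v) : LocalRing L v →* LocalRing L v) h.unit))⁻¹ : ℂˣ) : ℂ) *
            ((((unitModulusChar (LocalRing L v) h.unit)⁻¹ : ℝ≥0) : ℝ) : ℂ))
        else 0) n ∂μ = -(ε₀ * ((((Ideal.absNorm v.asIdeal : ℝ) : ℂ) - 1) / ((Ideal.absNorm v.asIdeal : ℝ) : ℂ) ^ 2) * ((μ.real {m : ↥(cmBorelTriple L 3 v).N | Valued.v (((((m : ↥(unitaryGroupOfForm (conjLocal L (IsCMField.complexConj L) v) (cmLocalForm L 3 v))) : GL (Fin 3) (LocalRing L v)) : Matrix (Fin 3) (Fin 3) (LocalRing L v)) 0 2) w) ≤ 1} : ℝ) : ℂ)))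
    (hred : ∃ N : Subrepresentation (cmPrincipalSeries L 3 v (cmTorusCharPair L v χ₁ 1)), N ≠ ⊥ ∧ N ≠ ⊤) :
    ∃ η : (LocalRing L v)ˣ →* ℂˣ, IsQuadraticCharExtension (conjLocal L (IsCMField.complexConj L) v) η ∧
      Continuous (fun x => ((η x : ℂˣ) : ℂ)) ∧ χ₁ = η * halfModulusChar (LocalRing L v) := by
  haveI := locallyCompactSpace_cmBorelU L 3 v
  -- `|Y| < 1` (contraction) for the closed forms
  have hY := K2E3KeysThmTwoDepthZeroBranchBConstants.norm_apply_uniformizer_lt_one L v w hw hunr χ₁ hcontr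
  -- the normalised `(I, χ̃)`-type basis (Branch B, depth zero)
  obtain ⟨f₁, f_w, heig₁, heig_w, h11, h1g, hw1, hwg⟩ :=
    K2E3BranchBTypeBasisCM.exists_normalised_typeBasis_of_depthZero_of_normChar_eq_one L v w hw eA heA hϖ g₁ hg₁ K0 K1 I hK0 hK1 hI w₀ hw₀ χ₁ hdepth hB
  -- the (II)-c heads for this basis
  have h11v := K2E3BranchBCasselmanPairClosedForms.integral_weyl_one_eq_of_shells L v w hw eA heA hϖ g₁ hg₁ K0 K1 I hK0 hK1 hI w₀ hw₀ χ₁ 1 μ f₁ heig₁ h11 h1g hSgt hSh0 hint ε₀ hY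
    hscal h1 h0
  have hwwv := K2E3BranchBCasselmanPairClosedForms.integral_weyl_weyl_eq_of_shells L v w hw eA heA hϖ g₁ hg₁ K0 K1 I hK0 hK1 hI w₀ hw₀ χ₁ 1 μ f_w heig_w hw1 hwg hSge ε₀ hY hscal h1 h0
  have hi₁₁ := K2E3BranchBCasselmanPairEntries.integrable_toFun_weyl_mul L v w hw eA heA hϖ g₁ hg₁ K0 K1 I hK0 hK1 hI w₀ hw₀ χ₁ 1 μ f₁ heig₁ h1g hSgt
    (hint.mono_set (fun m hm => by simp only [Set.mem_setOf_eq] at hm ⊢; exact le_of_lt hm))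
  have hiw₂ := K2E3BranchBCasselmanPairEntries.integrable_toFun_conj_weyl L v w hw eA heA hϖ g₁ hg₁ K0 K1 I hK0 hK1 hI w₀ hw₀ χ₁ 1 μ f_w heig_w hw1 hSge hint
  exact K2E3KeysThmTwoDepthZeroBranchBAssembly.exists_eta_of_reducible_of_bigCellEntries L v w hw eA heA hϖ g₁ hg₁ K0 K1 I hK0 hK1 hI hns χ₁ h₁ hnu hcontr hdepth hunr hB w₀ hw₀ μ
    f₁ f_w heig₁ heig_w h11 h1g hw1 hwg hi₁₁ hiw₂ ε₀ _ hε (K2E3BranchBCasselmanPairEntries.chi2_neg_one_sq L v 1) h11v hwwv hred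

/-! ## The same with the Borel-ness of the regions discharged (★ `K2E3BranchBShellRegions`) -/

open Classical in
include hw heA hϖ hg₁ hK0 hK1 hI hw₀ in
set_option maxHeartbeats 4000000 in
set_option synthInstance.maxHeartbeats 400000 in
-- as above
/-- **THE SOCKET :155 AT AN INERT PLACE, MODULO THE THREE SHELL IDENTITIES — regions discharged.**  As `exists_eta_of_reducible_of_shells`, without the three measurability letters
(the regions `S_gt`, `S_ge`, `Sh 0` are open ∕ closed in `N(L⁺_v)`, ★ `K2E3BranchBShellRegions`).  What remains hypothetical is exactly: `IntegrableOn F₀ S_ge` and the torus-scaling ∕ shell-one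
identities ((II)-a), the shell-zero identity ((II)-b3), and a sign `ε₀` with `ε₀² = 1`. [cite: Keys1984, §3, §7 Theorem (2) p. 126] [cite: Casselman1980, §3] [cite: Casselman1995, §6.4, Thm. 6.6.2]
[cite: Rogawski1990, §12.2 (1)–(2) p. 173] [cite: Roche1998, §3–§4] -/
theorem exists_eta_of_reducible_of_shellIdentities
    (hns : ∀ w' : PlacesOver L v, IsCMField.complexConj L • w'.1 = w'.1) (hunr : Algebra.IsUnramifiedIn (𝓞 L) v.asIdeal)
    (χ₁ : (LocalRing L v)ˣ →* ℂˣ) (h₁ : Continuous fun x => ((χ₁ x : ℂˣ) : ℂ)) (hnu : ∃ x, ‖((χ₁ x : ℂˣ) : ℂ)‖ ≠ 1)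
    (hcontr : ∀ x : (LocalRing L v)ˣ, unitModulusChar (LocalRing L v) x < 1 → ‖((χ₁ x : ℂˣ) : ℂ)‖ < 1)
    (hdepth : ∀ u : (LocalRing L v)ˣ, (∀ w' : PlacesOver L v, Valued.v (((u : LocalRing L v) w') - 1) < 1) → χ₁ u = 1)
    (hB : ∀ u : (LocalRing L v)ˣ, (∀ w' : PlacesOver L v, Valued.v ((u : LocalRing L v) w') = 1) →
      χ₁ (u * Units.map (conjLocal L (IsCMField.complexConj L) v : LocalRing L v →* LocalRing L v) u) = 1)
    [MeasurableSpace ↥(cmBorelTriple L 3 v).N] [BorelSpace ↥(cmBorelTriple L 3 v).N] (μ : Measure ↥(cmBorelTriple L 3 v).N) [μ.IsHaarMeasure]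
    (hint : IntegrableOn (fun n : ↥(cmBorelTriple L 3 v).N =>
        if h : IsUnit ((((n : ↥(unitaryGroupOfForm (conjLocal L (IsCMField.complexConj L) v) (cmLocalForm L 3 v))) : GL (Fin 3) (LocalRing L v)) : Matrix (Fin 3) (Fin 3) (LocalRing L v)) 0 2) then
          ((((χ₁ (Units.map ((conjLocal L (IsCMField.complexConj L) v) : LocalRing L v →* LocalRing L v) h.unit))⁻¹ : ℂˣ) : ℂ) *
            ((((unitModulusChar (LocalRing L v) h.unit)⁻¹ : ℝ≥0) : ℝ) : ℂ))
        else 0) {m : ↥(cmBorelTriple L 3 v).N | 1 ≤ Valued.v (((((m : ↥(unitaryGroupOfForm (conjLocal L (IsCMField.complexConj L) v) (cmLocalForm L 3 v))) : GL (Fin 3) (LocalRing L v)) : Matrix (Fin 3) (Fin 3) (LocalRing L v)) 0 2) w)} μ)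
    (ε₀ : ℂ) (hε : ε₀ ^ 2 = 1)
    (hscal : ∫ n in {m : ↥(cmBorelTriple L 3 v).N | 1 ≤ Valued.v (((((m : ↥(unitaryGroupOfForm (conjLocal L (IsCMField.complexConj L) v) (cmLocalForm L 3 v))) : GL (Fin 3) (LocalRing L v)) : Matrix (Fin 3) (Fin 3) (LocalRing L v)) 0 2) w)}, (fun n : ↥(cmBorelTriple L 3 v).N =>
        if h : IsUnit ((((n : ↥(unitaryGroupOfForm (conjLocal L (IsCMField.complexConj L) v) (cmLocalForm L 3 v))) : GL (Fin 3) (LocalRing L v)) : Matrix (Fin 3) (Fin 3) (LocalRing L v)) 0 2) then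
          ((((χ₁ (Units.map ((conjLocal L (IsCMField.complexConj L) v) : LocalRing L v →* LocalRing L v) h.unit))⁻¹ : ℂˣ) : ℂ) *
            ((((unitModulusChar (LocalRing L v) h.unit)⁻¹ : ℝ≥0) : ℝ) : ℂ))
        else 0) n ∂μ =
      (∫ n in {m : ↥(cmBorelTriple L 3 v).N | Valued.v (((((m : ↥(unitaryGroupOfForm (conjLocal L (IsCMField.complexConj L) v) (cmLocalForm L 3 v))) : GL (Fin 3) (LocalRing L v)) : Matrix (Fin 3) (Fin 3) (LocalRing L v)) 0 2) w) = 1}, (fun n : ↥(cmBorelTriple L 3 v).N =>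
        if h : IsUnit ((((n : ↥(unitaryGroupOfForm (conjLocal L (IsCMField.complexConj L) v) (cmLocalForm L 3 v))) : GL (Fin 3) (LocalRing L v)) : Matrix (Fin 3) (Fin 3) (LocalRing L v)) 0 2) then
          ((((χ₁ (Units.map ((conjLocal L (IsCMField.complexConj L) v) : LocalRing L v →* LocalRing L v) h.unit))⁻¹ : ℂˣ) : ℂ) *
            ((((unitModulusChar (LocalRing L v) h.unit)⁻¹ : ℝ≥0) : ℝ) : ℂ))
        else 0) n ∂μ) + (∫ n in {m : ↥(cmBorelTriple L 3 v).N | Valued.v (((((m : ↥(unitaryGroupOfForm (conjLocal L (IsCMField.complexConj L) v) (cmLocalForm L 3 v))) : GL (Fin 3) (LocalRing L v)) : Matrix (Fin 3) (Fin 3) (LocalRing L v)) 0 2) w) = WithZero.exp (1 : ℤ)}, (fun n : ↥(cmBorelTriple L 3 v).N =>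
        if h : IsUnit ((((n : ↥(unitaryGroupOfForm (conjLocal L (IsCMField.complexConj L) v) (cmLocalForm L 3 v))) : GL (Fin 3) (LocalRing L v)) : Matrix (Fin 3) (Fin 3) (LocalRing L v)) 0 2) then
          ((((χ₁ (Units.map ((conjLocal L (IsCMField.complexConj L) v) : LocalRing L v →* LocalRing L v) h.unit))⁻¹ : ℂˣ) : ℂ) *
            ((((unitModulusChar (LocalRing L v) h.unit)⁻¹ : ℝ≥0) : ℝ) : ℂ))
        else 0) n ∂μ) +
        ((χ₁ (isUnit_toLocalRing_uniformizer L v).unit : ℂˣ) : ℂ) ^ 2 * ∫ n in {m : ↥(cmBorelTriple L 3 v).N | 1 ≤ Valued.v (((((m : ↥(unitaryGroupOfForm (conjLocal L (IsCMField.complexConj L) v) (cmLocalForm L 3 v))) : GL (Fin 3) (LocalRing L v)) : Matrix (Fin 3) (Fin 3) (LocalRing L v)) 0 2) w)}, (fun n : ↥(cmBorelTriple L 3 v).N =>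
        if h : IsUnit ((((n : ↥(unitaryGroupOfForm (conjLocal L (IsCMField.complexConj L) v) (cmLocalForm L 3 v))) : GL (Fin 3) (LocalRing L v)) : Matrix (Fin 3) (Fin 3) (LocalRing L v)) 0 2) then
          ((((χ₁ (Units.map ((conjLocal L (IsCMField.complexConj L) v) : LocalRing L v →* LocalRing L v) h.unit))⁻¹ : ℂˣ) : ℂ) *
            ((((unitModulusChar (LocalRing L v) h.unit)⁻¹ : ℝ≥0) : ℝ) : ℂ))
        else 0) n ∂μ)
    (h1 : ∫ n in {m : ↥(cmBorelTriple L 3 v).N | Valued.v (((((m : ↥(unitaryGroupOfForm (conjLocal L (IsCMField.complexConj L) v) (cmLocalForm L 3 v))) : GL (Fin 3) (LocalRing L v)) : Matrix (Fin 3) (Fin 3) (LocalRing L v)) 0 2) w) = WithZero.exp (1 : ℤ)}, (fun n : ↥(cmBorelTriple L 3 v).N =>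
        if h : IsUnit ((((n : ↥(unitaryGroupOfForm (conjLocal L (IsCMField.complexConj L) v) (cmLocalForm L 3 v))) : GL (Fin 3) (LocalRing L v)) : Matrix (Fin 3) (Fin 3) (LocalRing L v)) 0 2) then
          ((((χ₁ (Units.map ((conjLocal L (IsCMField.complexConj L) v) : LocalRing L v →* LocalRing L v) h.unit))⁻¹ : ℂˣ) : ℂ) *
            ((((unitModulusChar (LocalRing L v) h.unit)⁻¹ : ℝ≥0) : ℝ) : ℂ))
        else 0) n ∂μ =
      ε₀ * ((χ₁ (isUnit_toLocalRing_uniformizer L v).unit : ℂˣ) : ℂ) * ((((Ideal.absNorm v.asIdeal : ℝ) : ℂ) - 1) / ((Ideal.absNorm v.asIdeal : ℝ) : ℂ) ^ 2) * ((μ.real {m : ↥(cmBorelTriple L 3 v).N | Valued.v (((((m : ↥(unitaryGroupOfForm (conjLocal L (IsCMField.complexConj L) v) (cmLocalForm L 3 v))) : GL (Fin 3) (LocalRing L v)) : Matrix (Fin 3) (Fin 3) (LocalRing L v)) 0 2) w) ≤ 1} : ℝ) : ℂ))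
    (h0 : ∫ n in {m : ↥(cmBorelTriple L 3 v).N | Valued.v (((((m : ↥(unitaryGroupOfForm (conjLocal L (IsCMField.complexConj L) v) (cmLocalForm L 3 v))) : GL (Fin 3) (LocalRing L v)) : Matrix (Fin 3) (Fin 3) (LocalRing L v)) 0 2) w) = 1}, (fun n : ↥(cmBorelTriple L 3 v).N =>
        if h : IsUnit ((((n : ↥(unitaryGroupOfForm (conjLocal L (IsCMField.complexConj L) v) (cmLocalForm L 3 v))) : GL (Fin 3) (LocalRing L v)) : Matrix (Fin 3) (Fin 3) (LocalRing L v)) 0 2) then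
          ((((χ₁ (Units.map ((conjLocal L (IsCMField.complexConj L) v) : LocalRing L v →* LocalRing L v) h.unit))⁻¹ : ℂˣ) : ℂ) *
            ((((unitModulusChar (LocalRing L v) h.unit)⁻¹ : ℝ≥0) : ℝ) : ℂ))
        else 0) n ∂μ = -(ε₀ * ((((Ideal.absNorm v.asIdeal : ℝ) : ℂ) - 1) / ((Ideal.absNorm v.asIdeal : ℝ) : ℂ) ^ 2) * ((μ.real {m : ↥(cmBorelTriple L 3 v).N | Valued.v (((((m : ↥(unitaryGroupOfForm (conjLocal L (IsCMField.complexConj L) v) (cmLocalForm L 3 v))) : GL (Fin 3) (LocalRing L v)) : Matrix (Fin 3) (Fin 3) (LocalRing L v)) 0 2) w) ≤ 1} : ℝ) : ℂ)))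
    (hred : ∃ N : Subrepresentation (cmPrincipalSeries L 3 v (cmTorusCharPair L v χ₁ 1)), N ≠ ⊥ ∧ N ≠ ⊤) :
    ∃ η : (LocalRing L v)ˣ →* ℂˣ, IsQuadraticCharExtension (conjLocal L (IsCMField.complexConj L) v) η ∧
      Continuous (fun x => ((η x : ℂˣ) : ℂ)) ∧ χ₁ = η * halfModulusChar (LocalRing L v) :=
  exists_eta_of_reducible_of_shells L v w hw eA heA hϖ g₁ hg₁ K0 K1 I hK0 hK1 hI w₀ hw₀ hns hunr χ₁ h₁ hnu hcontr hdepth hB μ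
    (K2E3BranchBShellRegions.measurableSet_setOf_one_lt_v L v w) (K2E3BranchBShellRegions.measurableSet_setOf_one_le_v L v w)
    (K2E3BranchBShellRegions.measurableSet_setOf_v_eq_one L v w) hint ε₀ hε hscal h1 h0 hred

end Summit.HodgeConjecture.HodgeConjecture.Cruxes.H413.K2E3KeysThmTwoDepthZeroBranchBInert

end
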